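import Literature.MathematicalPhysics.QuantumManyBody.PeriodicMaxFormBoundHardCore
import HarnessLib

/-!
# MaxFormApproximation for hard cores, part 1/3: bookkeeping of the cut-off product

Helper file (part 1 of 3) for the stub `stub_maxFormApproximationFiniteRange` (S-B) of line
`near-minimiser-slack-transfer` of the crux `BECConjugateDomination.HardCoreExtension`
(item stmt-AtomisticToContinuum-11786): the elementary `L²((ℝ/ℤ)^{3N})` bookkeeping (Haar probability measure, as in
`PeriodicFormDomain.lean`) behind the cut-off step of `PeriodicMaxFormBoundHardCoreStep.lean` once the `L²`-closeness
is kept. For `P, ζ ∈ L²`, a measurable `A ⊆ (ℝ³)^N` and a real cut-off `ξ ∈ [0, 1]` equal to `1` off `A`: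

* `lintegral_cutoff_mul_sub_sq_le` — `∫ |ξ(fromUnitTorusN L t) P - ζ|² ≤ 2‖P - ζ‖² + 2∫_{fromUnitTorusN L ⁻¹' A} |ζ|²`
  (the distance of the cut-off product to the target);
* `lintegral_indicator_mul_sq_le` — `∫ 1_A(fromUnitTorusN L t) |P|² ≤ 2∫_{fromUnitTorusN L ⁻¹' A} |ζ|² + 2‖P - ζ‖²`
  (the mass of `P` on the layer);
* `cutoffStep_energyBudget`, `cutoffStep_distBudget` — the two real-arithmetic error budgets of the step.

References: B. Simon, *Maximal and minimal Schrödinger forms*, J. Operator Theory 1 (1979) 37–47, Thm. 2.1;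
[ReedSimonIV1978] Thm. XIII.64.
-/

noncomputable section

namespace Summit.AtomisticToContinuum.BoseEinsteinCondensation.Cruxes.HardCoreExtension.NearMinTower

open MeasureTheory Filter Set
open scoped ENNReal NNReal Topology
open Literature.MathematicalPhysics.QuantumManyBody.BoseGas
open Literature.MathematicalPhysics.QuantumManyBody.BoseGas.HardLayerAux
open UnitAddTorus

attribute [local instance] Literature.MathematicalPhysics.QuantumManyBody.BoseGas.formDomain_measureSpace
  Literature.MathematicalPhysics.QuantumManyBody.BoseGas.formDomain_isProbabilityMeasure
  Literature.MathematicalPhysics.QuantumManyBody.BoseGas.formDomain_isProbabilityMeasure_pi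

variable {N : ℕ}

/-! ### `L²` bookkeeping of the cut-off product -/

/-- `|a + b|² ≤ 2|a|² + 2|b|²` in `ℝ≥0∞`. [folklore] -/
theorem nnnorm_add_sq_le (a b : ℂ) :
    ((‖a + b‖₊ : ℝ≥0∞)) ^ 2 ≤ 2 * (‖a‖₊ : ℝ≥0∞) ^ 2 + 2 * (‖b‖₊ : ℝ≥0∞) ^ 2 := by
  have htwo : ∀ x : ℝ, (2 : ℝ≥0∞) * ENNReal.ofReal x = ENNReal.ofReal (2 * x) := fun x => by
    rw [ENNReal.ofReal_mul (by norm_num), ENNReal.ofReal_ofNat]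
  rw [coe_nnnorm_sq_eq_ofReal, coe_nnnorm_sq_eq_ofReal, coe_nnnorm_sq_eq_ofReal, htwo, htwo,
    ← ENNReal.ofReal_add (by positivity) (by positivity)]
  refine ENNReal.ofReal_le_ofReal ?_
  have h2 := pow_le_pow_left₀ (norm_nonneg _) (norm_add_le a b) 2
  nlinarith [h2, sq_nonneg (‖a‖ - ‖b‖)]

/-- For `0 ≤ r ≤ 1` and `p, z ∈ ℂ`: `|r p - z|² ≤ 2|p - z|² + 2|z|²` (`r p - z = r(p - z) + (r - 1)z`). [folklore] -/
theorem nnnorm_ofReal_mul_sub_sq_le {r : ℝ} (hr : 0 ≤ r ∧ r ≤ 1) (p z : ℂ) :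
    ((‖(r : ℂ) * p - z‖₊ : ℝ≥0∞)) ^ 2 ≤ 2 * (‖p - z‖₊ : ℝ≥0∞) ^ 2 + 2 * (‖z‖₊ : ℝ≥0∞) ^ 2 := by
  have htwo : ∀ x : ℝ, (2 : ℝ≥0∞) * ENNReal.ofReal x = ENNReal.ofReal (2 * x) := fun x => by
    rw [ENNReal.ofReal_mul (by norm_num), ENNReal.ofReal_ofNat]
  rw [coe_nnnorm_sq_eq_ofReal, coe_nnnorm_sq_eq_ofReal, coe_nnnorm_sq_eq_ofReal, htwo, htwo,
    ← ENNReal.ofReal_add (by positivity) (by positivity)]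
  refine ENNReal.ofReal_le_ofReal ?_
  have h1 : ‖(r : ℂ) * p - z‖ ≤ ‖p - z‖ + ‖z‖ := by
    have heq : (r : ℂ) * p - z = (r : ℂ) * (p - z) + ((r - 1 : ℝ) : ℂ) * z := by push_cast; ring
    rw [heq]
    refine (norm_add_le _ _).trans (add_le_add ?_ ?_)
    · rw [norm_mul, Complex.norm_real, Real.norm_of_nonneg hr.1]
      exact mul_le_of_le_one_left (norm_nonneg _) hr.2
    · rw [norm_mul, Complex.norm_real, Real.norm_eq_abs, abs_sub_comm, abs_of_nonneg (by linarith)]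
      exact mul_le_of_le_one_left (norm_nonneg _) (by linarith)
  have h2 := pow_le_pow_left₀ (norm_nonneg _) h1 2
  nlinarith [h2, sq_nonneg (‖p - z‖ - ‖z‖)]

/-- **`L²` bookkeeping of the cut-off product.** For `P, ζ ∈ L²((ℝ/ℤ)^{3N})`, a measurable `A ⊆ (ℝ³)^N` and a
real cut-off `ξ ∈ [0, 1]` equal to `1` off `A`:
`∫ |ξ(fromUnitTorusN L t) P(t) - ζ(t)|² ≤ 2‖P - ζ‖² + 2∫_{fromUnitTorusN L ⁻¹' A} |ζ|²`. [folklore] -/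
theorem lintegral_cutoff_mul_sub_sq_le :
    ∀ {N : ℕ} {ξ : Config N → ℝ}, (∀ X, 0 ≤ ξ X ∧ ξ X ≤ 1) → ∀ {A : Set (Config N)}, MeasurableSet A →
      (∀ X ∉ A, ξ X = 1) → ∀ (L : ℝ) (P ζ : Lp ℂ 2 (volume : Measure (UnitAddTorus (Fin N × Fin 3)))),
      ∫⁻ t, ((‖(ξ (fromUnitTorusN L t) : ℂ) * (P : UnitAddTorus (Fin N × Fin 3) → ℂ) t -
          (ζ : UnitAddTorus (Fin N × Fin 3) → ℂ) t‖₊ : ℝ≥0∞)) ^ 2 ≤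
        2 * ENNReal.ofReal (‖P - ζ‖ ^ 2) +
          2 * ∫⁻ t in fromUnitTorusN L ⁻¹' A, ((‖(ζ : UnitAddTorus (Fin N × Fin 3) → ℂ) t‖₊ : ℝ≥0∞)) ^ 2 := by
  intro N ξ h01 A hA h1 L P ζ
  have hsub : ∀ᵐ t ∂(volume : Measure (UnitAddTorus (Fin N × Fin 3))),
      ((P - ζ : Lp ℂ 2 volume) : UnitAddTorus (Fin N × Fin 3) → ℂ) t =
        (P : UnitAddTorus (Fin N × Fin 3) → ℂ) t - (ζ : UnitAddTorus (Fin N × Fin 3) → ℂ) t := Lp.coeFn_sub P ζ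
  have hle : ∫⁻ t, ((‖(ξ (fromUnitTorusN L t) : ℂ) * (P : UnitAddTorus (Fin N × Fin 3) → ℂ) t -
        (ζ : UnitAddTorus (Fin N × Fin 3) → ℂ) t‖₊ : ℝ≥0∞)) ^ 2 ≤
      ∫⁻ t, (2 * ((‖((P - ζ : Lp ℂ 2 volume) : UnitAddTorus (Fin N × Fin 3) → ℂ) t‖₊ : ℝ≥0∞)) ^ 2 +
        2 * (A.indicator (1 : Config N → ℝ≥0∞) (fromUnitTorusN L t) *
          ((‖(ζ : UnitAddTorus (Fin N × Fin 3) → ℂ) t‖₊ : ℝ≥0∞)) ^ 2)) := by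
    refine lintegral_mono_ae (hsub.mono fun t ht => ?_)
    rw [ht]
    by_cases hX : fromUnitTorusN L t ∈ A
    · rw [indicator_of_mem hX, Pi.one_apply, one_mul]
      exact nnnorm_ofReal_mul_sub_sq_le (h01 _) _ _
    · rw [h1 _ hX, indicator_of_notMem hX, zero_mul, mul_zero, add_zero, Complex.ofReal_one, one_mul]
      calc ((‖(P : UnitAddTorus (Fin N × Fin 3) → ℂ) t - (ζ : UnitAddTorus (Fin N × Fin 3) → ℂ) t‖₊ : ℝ≥0∞)) ^ 2
          = 1 * _ := (one_mul _).symm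
        _ ≤ 2 * _ := by gcongr; norm_num
  refine hle.trans ?_
  have hm : AEMeasurable (fun t => 2 * ((‖((P - ζ : Lp ℂ 2 volume) : UnitAddTorus (Fin N × Fin 3) → ℂ) t‖₊ :
      ℝ≥0∞)) ^ 2) volume :=
    ((Lp.stronglyMeasurable _).measurable.nnnorm.coe_nnreal_ennreal.pow_const 2).aemeasurable.const_mul _
  rw [lintegral_add_left' hm, lintegral_const_mul' _ _ (by norm_num), lintegral_const_mul' _ _ (by norm_num),
    lintegral_indicator_preimage_mul' hA]
  refine add_le_add (mul_le_mul_right (le_of_eq ?_) _) le_rfl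
  rw [(norm_Lp_two_sq_eq_toReal (P - ζ)).1, ENNReal.ofReal_toReal (norm_Lp_two_sq_eq_toReal (P - ζ)).2]

/-- **Mass of `P` on a layer against the target**: for `P, ζ ∈ L²((ℝ/ℤ)^{3N})` and a measurable `A ⊆ (ℝ³)^N`,
`∫ 1_A(fromUnitTorusN L t) |P(t)|² ≤ 2∫_{fromUnitTorusN L ⁻¹' A} |ζ|² + 2‖P - ζ‖²`. [folklore] -/
theorem lintegral_indicator_mul_sq_le {A : Set (Config N)} (hA : MeasurableSet A) (L : ℝ)
    (P ζ : Lp ℂ 2 (volume : Measure (UnitAddTorus (Fin N × Fin 3)))) :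
    ∫⁻ t, A.indicator (1 : Config N → ℝ≥0∞) (fromUnitTorusN L t) *
        ((‖(P : UnitAddTorus (Fin N × Fin 3) → ℂ) t‖₊ : ℝ≥0∞)) ^ 2 ≤
      2 * (∫⁻ t in fromUnitTorusN L ⁻¹' A, ((‖(ζ : UnitAddTorus (Fin N × Fin 3) → ℂ) t‖₊ : ℝ≥0∞)) ^ 2) +
        2 * ENNReal.ofReal (‖P - ζ‖ ^ 2) := by
  have hsub : ∀ᵐ t ∂(volume : Measure (UnitAddTorus (Fin N × Fin 3))),
      ((P - ζ : Lp ℂ 2 volume) : UnitAddTorus (Fin N × Fin 3) → ℂ) t =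
        (P : UnitAddTorus (Fin N × Fin 3) → ℂ) t - (ζ : UnitAddTorus (Fin N × Fin 3) → ℂ) t := Lp.coeFn_sub P ζ
  have h1 : ∫⁻ t, A.indicator (1 : Config N → ℝ≥0∞) (fromUnitTorusN L t) *
        ((‖(P : UnitAddTorus (Fin N × Fin 3) → ℂ) t‖₊ : ℝ≥0∞)) ^ 2 ≤
      ∫⁻ t, (2 * (A.indicator (1 : Config N → ℝ≥0∞) (fromUnitTorusN L t) *
        ((‖(ζ : UnitAddTorus (Fin N × Fin 3) → ℂ) t‖₊ : ℝ≥0∞)) ^ 2) +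
          2 * ((‖((P - ζ : Lp ℂ 2 volume) : UnitAddTorus (Fin N × Fin 3) → ℂ) t‖₊ : ℝ≥0∞)) ^ 2) := by
    refine lintegral_mono_ae (hsub.mono fun t ht => ?_)
    rw [ht]
    by_cases hX : fromUnitTorusN L t ∈ A
    · rw [indicator_of_mem hX, Pi.one_apply, one_mul, one_mul]
      have h := nnnorm_add_sq_le ((ζ : UnitAddTorus (Fin N × Fin 3) → ℂ) t)
        ((P : UnitAddTorus (Fin N × Fin 3) → ℂ) t - (ζ : UnitAddTorus (Fin N × Fin 3) → ℂ) t)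
      rwa [add_sub_cancel] at h
    · rw [indicator_of_notMem hX]
      simp
  have hζm : AEMeasurable (fun t => 2 * (A.indicator (1 : Config N → ℝ≥0∞) (fromUnitTorusN L t) *
      ((‖(ζ : UnitAddTorus (Fin N × Fin 3) → ℂ) t‖₊ : ℝ≥0∞)) ^ 2)) volume :=
    (((measurable_one.indicator hA).comp (measurable_fromUnitTorusN L)).mul
      ((Lp.stronglyMeasurable ζ).measurable.nnnorm.coe_nnreal_ennreal.pow_const 2)).aemeasurable.const_mul _
  refine h1.trans ?_
  rw [lintegral_add_left' hζm, lintegral_const_mul' _ _ (by norm_num), lintegral_const_mul' _ _ (by norm_num),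
    lintegral_indicator_preimage_mul' hA]
  rw [← ENNReal.ofReal_toReal (norm_Lp_two_sq_eq_toReal (P - ζ)).2, ← (norm_Lp_two_sq_eq_toReal (P - ζ)).1]

/-! ### The two error budgets (pure arithmetic) -/

/-- The energy budget of the cut-off step: with `A₁ = (1 + ε⁻¹)·3N·C²`, `cD = (1 + ε⁻¹)·3N·(C/s)²`,
`ε' ≤ ε/(8(A₁ + 1))`, `e ≤ ε/8`, `e ≤ 1`, `e ≤ s²ε/(8(A₁ + 1))`, one has `cD(2ε's² + 2e²) + e ≤ ε`. [folklore] -/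
theorem cutoffStep_energyBudget {ε C s ε' e A₁ cD : ℝ} {N : ℕ} (hε : 0 < ε) (hs : 0 < s)
    (hA₁ : A₁ = (1 + ε⁻¹) * (3 * N) * C ^ 2) (hcD : cD = (1 + ε⁻¹) * (3 * N) * (C / s) ^ 2)
    (hε'le : ε' ≤ ε / (8 * (A₁ + 1))) (he0 : 0 ≤ e) (he8 : e ≤ ε / 8) (he1 : e ≤ 1)
    (hes : e ≤ s ^ 2 * ε / (8 * (A₁ + 1))) :
    cD * (2 * (ε' * s ^ 2) + 2 * e ^ 2) + e ≤ ε := by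
  have hA₁0 : 0 ≤ A₁ := by rw [hA₁]; positivity
  have hcD0 : 0 ≤ cD := by rw [hcD]; positivity
  have h1 : cD * (ε' * s ^ 2) = A₁ * ε' := by rw [hcD, hA₁]; field_simp
  have h2 : A₁ * ε' ≤ ε / 8 := by
    refine (mul_le_mul_of_nonneg_left hε'le hA₁0).trans ?_
    rw [mul_div_assoc', div_le_div_iff₀ (by positivity) (by norm_num)]
    nlinarith only [hA₁0, hε]
  have h3 : cD * e ^ 2 ≤ ε / 8 := by
    have h4 : e ^ 2 ≤ e * (s ^ 2 * ε / (8 * (A₁ + 1))) := by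
      rw [sq]; exact mul_le_mul_of_nonneg_left hes he0
    have h5 : cD * (s ^ 2 * ε / (8 * (A₁ + 1))) = A₁ * ε / (8 * (A₁ + 1)) := by rw [hcD, hA₁]; field_simp
    have h6 : A₁ * ε / (8 * (A₁ + 1)) ≤ ε / 8 := by
      rw [div_le_div_iff₀ (by positivity) (by norm_num)]; nlinarith only [hA₁0, hε]
    calc cD * e ^ 2 ≤ cD * (e * (s ^ 2 * ε / (8 * (A₁ + 1)))) := mul_le_mul_of_nonneg_left h4 hcD0
      _ = e * (cD * (s ^ 2 * ε / (8 * (A₁ + 1)))) := by ring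
      _ ≤ 1 * (ε / 8) := by rw [h5]; exact mul_le_mul he1 h6 (by positivity) zero_le_one
      _ = ε / 8 := one_mul _
  have h7 : cD * (2 * (ε' * s ^ 2) + 2 * e ^ 2) = 2 * (cD * (ε' * s ^ 2)) + 2 * (cD * e ^ 2) := by ring
  rw [h7, h1]
  linarith only [h2, h3, he8, hε]

/-- The distance budget of the cut-off step: `d² ≤ 2e² + 2ε's²` with `e ≤ ε/8`, `ε' ≤ ε²/4`, `s ≤ 1` give `d ≤ ε`.
[folklore] -/
theorem cutoffStep_distBudget {ε s ε' e d : ℝ} (hε : 0 < ε) (hs : 0 < s) (hs1 : s ≤ 1) (hε'0 : 0 ≤ ε')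
    (hε'sq : ε' ≤ ε ^ 2 / 4) (he0 : 0 ≤ e) (he8 : e ≤ ε / 8) (hd : 0 ≤ d)
    (hreal : d ^ 2 ≤ 2 * e ^ 2 + 2 * (ε' * s ^ 2)) : d ≤ ε := by
  have hs2 : s ^ 2 ≤ 1 := pow_le_one₀ hs.le hs1
  have h1 : ε' * s ^ 2 ≤ ε ^ 2 / 4 := (mul_le_mul_of_nonneg_left hs2 hε'0).trans (by linarith only [hε'sq])
  have h2 : e ^ 2 ≤ (ε / 8) ^ 2 := pow_le_pow_left₀ he0 he8 2
  have hbound : d ^ 2 ≤ ε ^ 2 := by nlinarith only [hreal, h1, h2, hε]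
  exact (pow_le_pow_iff_left₀ hd hε.le two_ne_zero).1 hbound

end Summit.AtomisticToContinuum.BoseEinsteinCondensation.Cruxes.HardCoreExtension.NearMinTower

end
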